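import Summits.SmoothPoincare4.SmoothPoincare4.Theorems.EntropyRungChangGurskyYangHelperRegularityInduction
import Summits.SmoothPoincare4.SmoothPoincare4.Theorems.EntropyRungChangGurskyYangHelperDifferentiateEquation
import Summits.SmoothPoincare4.SmoothPoincare4.Theorems.EntropyRungChangGurskyYangHelperDqRegularityStep
import HarnessLib

/-!
# Helper `helper_regularityInduction` of line `margerin-cone-hamilton-rails`
# (crux `EntropyRung.ChangGurskyYang`, item stmt-SmoothPoincare4-10834):
# the elliptic regularity induction `C^{2,α} ⇒ C^{m+3,α}`, unconditionally

Registered helper stub Rind of the lead's skeleton of line `margerin-cone-hamilton-rails`: the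
regularity induction for `C^{2,α}` solutions of `H(c(y), cjet₂ v(y)) = 0` with `H` smooth,
`c ∈ C^{m+1,α}` and uniform ellipticity near the graph (Gilbarg–Trudinger 2001, Lemma 17.16,
regularity half), obtained by feeding the two landed steps — R3gen
`helper_dqRegularityStep` (difference quotients, `C^{2,α} ⇒ C^{3,α}`) and Rdiff
`helper_differentiateEquation` (differentiating the equation once) — into the conditional form
`helper_regularityInduction_of`
(`Summits/SmoothPoincare4/SmoothPoincare4/Theorems/EntropyRungChangGurskyYangHelperRegularityInduction.lean`).

References: D. Gilbarg, N. S. Trudinger, *Elliptic Partial Differential Equations of Second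
Order* (2001), Lemma 17.16 [GilbargTrudinger2001].
-/

noncomputable section

-- every `Summit.SmoothPoincare4.SmoothPoincare4.…` name repeats the summit = sub-problem segment (D-0017 layout)
set_option linter.dupNamespace false

namespace Summit.SmoothPoincare4.SmoothPoincare4.Theorems.MargerinRails

/-- **Rind: the elliptic regularity induction** (Gilbarg–Trudinger 2001, Lemma 17.16, regularity
half): for every `m`, every finite-dimensional parameter space `P`, smooth
`H : P × CJet ι 2 → ℝ`, `c ∈ C^{m+1,α}(B(x₀, R))` with bounds and every `C^{2,α}` solution `v`
of `H(c(y), cjet₂ v(y)) = 0` on `B(x₀, R)` with bounds, uniformly elliptic near the graph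
`(c, cjet₂ v)`, the solution is `C^{m+3,α}` with bounds on `B(x₀, ρ)` for all `0 < ρ < R`
(`helper_regularityInduction_of` applied to `helper_dqRegularityStep` and
`helper_differentiateEquation`). [cite: GilbargTrudinger2001, Lemma 17.16] -/
theorem helper_regularityInduction :
    ∀ {ι : Type} [Fintype ι] [DecidableEq ι] {E : Type} [NormedAddCommGroup E] [InnerProductSpace ℝ E]
      [FiniteDimensional ℝ E] [MeasurableSpace E] [BorelSpace E] [Nontrivial E]
      (bE : OrthonormalBasis ι ℝ E) {α : NNReal}, 0 < α → α < 1 → ∀ (m : ℕ)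
      {P : Type} [NormedAddCommGroup P] [NormedSpace ℝ P] [FiniteDimensional ℝ P]
      (H : P × Literature.Analysis.Calculus.CJet ι 2 → ℝ),
      ContDiff ℝ ((⊤ : ℕ∞) : WithTop ℕ∞) H →
      ∀ (c : E → P) (v : E → ℝ) (x₀ : E) (R : ℝ), 0 < R →
      ContDiffOn ℝ (m + 1) c (Metric.ball x₀ R) →
      (∃ Bc : NNReal, (∀ y ∈ Metric.ball x₀ R, ∀ j ≤ m + 1, ‖iteratedFDeriv ℝ j c y‖ ≤ Bc) ∧
        HolderOnWith Bc α (iteratedFDeriv ℝ (m + 1) c) (Metric.ball x₀ R)) →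
      ContDiffOn ℝ 2 v (Metric.ball x₀ R) →
      (∃ Bv : NNReal, (∀ y ∈ Metric.ball x₀ R, ∀ j ≤ 2, ‖iteratedFDeriv ℝ j v y‖ ≤ Bv) ∧
        HolderOnWith Bv α (iteratedFDeriv ℝ 2 v) (Metric.ball x₀ R)) →
      (∀ y ∈ Metric.ball x₀ R, H (c y, Literature.Analysis.Calculus.cjetOf bE 2 v y) = 0) →
      (∃ l δ : ℝ, 0 < l ∧ 0 < δ ∧ ∀ y ∈ Metric.ball x₀ R,
        ∀ (p' : P) (J' : Literature.Analysis.Calculus.CJet ι 2),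
          ‖p' - c y‖ < δ → ‖J' - Literature.Analysis.Calculus.cjetOf bE 2 v y‖ < δ →
          ∀ η : E →L[ℝ] ℝ, l * ‖η‖ ^ 2 ≤
            fderiv ℝ H (p', J') ((0 : P), Pi.single (Fin.last 2)
              (fun I : Fin 2 → ι => η (bE (I 0)) * η (bE (I 1))))) →
      ∀ ρ : ℝ, 0 < ρ → ρ < R →
        ContDiffOn ℝ (m + 3) v (Metric.ball x₀ ρ) ∧
        ∃ B' : NNReal, (∀ y ∈ Metric.ball x₀ ρ, ∀ j ≤ m + 3, ‖iteratedFDeriv ℝ j v y‖ ≤ B') ∧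
          HolderOnWith B' α (iteratedFDeriv ℝ (m + 3) v) (Metric.ball x₀ ρ) :=
  helper_regularityInduction_of helper_dqRegularityStep helper_differentiateEquation

end Summit.SmoothPoincare4.SmoothPoincare4.Theorems.MargerinRails
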